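import Summits.QuantumFields.BalabanUV.Beta.GAN24.ExponentialChartTower

/-!
# `BalabanUV.Beta.GAN24.ExponentialChartHessianForm` — binder row G-an2-4 ∕ (CONV-C), route R7 «TWO CURRENCIES», PART 257: THE ONE-LOOP HESSIAN OF THE EXACT ABELIAN COVARIANT VECTOR
# LAPLACIAN IN BAŁABAN's CHART IS A SYMMETRIC BILINEAR FORM WHOSE DIAGONAL IS PART 247's `N = 2` OBJECT.  `H(A, B) := ∂_r|₀∂_s|₀[(L^{dk}Q_k(Δ_a^{(k)} + covPert e^{iη(sA + rB)} k)⁻¹Q_kᴴ)⁻¹]`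
# (every volume, every level, any REAL connections): `H(A, B) = H(B, A)` (a THEOREM — no joint differentiability was ever assumed; PART 255's polarisation), `H(A₁ + A₂, B) = H(A₁, B) + H(A₂, B)`,
# `H(cA, B) = c·H(A, B)` (PART 254's five diagrams: the letters `−iA`, `−(iA)(iB)∕n`, `−2Σ_ν(iA_ν)(iB_ν)` are linear in `A`, the read-out is linear; symmetry gives linearity in `B`), and
# `H(A, A) = ∂²_s|₀[… covPert e^{isηA} …]` (at `B = A` the mixed letter IS the second letter of the chart of `A`; PART 256's explicit bubble + tadpole).  With PART 254 (END of every entry) the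
# vacuum-polarisation tensor of the exact abelian covariant vector Laplacian is a symmetric bilinear form of volume-indexed real Lipschitz connections, every entry of which has the β-cell's
# `LimitRate` END on `ℤ^d` (unit b2b-balaban-gan24-p3, gen 66; v1; generator `HOME/b2b-balaban-gan24-p3/gen66/records/gen/gen256.py`)

NOT IN PRINT; OUR PROOF ([folklore] bookkeeping BY NAME over PART 254 (`deriv_deriv_invCov_expChart₂_eq_mixedDiagram`), PART 255 (`deriv_deriv_invCov_expChart₂_eq_half_polarisation`), PART 256
(`iteratedDeriv_two_invCov_expChart_eq`), PART 253 (`jetV_one_add`, `Pmodel_add'`, `couplingLetter_add`), PART 241 (`Pmodel_apply`), PART 161 (`exists_clm_avgTow`); Mathlib's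
`Matrix.conjTranspose_smul`, `Matrix.diagonal_smul`, `sub_right_comm`; [Balaban1985BackgroundPropagators] (3.3) p. 390, (3.35) p. 396 and [Balaban1987RG1] (1.20)–(1.22) p. 264 LOCATE the
shapes; nothing printed is a hypothesis).
HONEST FRAMING (cell contract, verbatim): «discharging `BetaPertH` makes Bałaban's UV stability UNCONDITIONAL — a real constructive-QFT result; it is NOT the
continuum limit and NOT the Clay problem.»  HONEST DEPENDENCY (verbatim): «continuum YM on T⁴ ⇐ BetaPertH ∧ nine spine estimates (0/9 proved); BetaPertH ⇐
(D1) ∧ (D4) ∧ CAP+tail; G-an2-4 gates asym, D1 and NE2/3/4.»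

WHAT THIS FILE PROVES (0 sorry, 0 `def`; `U^{A,B}_{s,r} k ν x = exp((I·A k ν x∕n_k)·s + (I·B k ν x∕n_k)·r)`, all connections REAL, every volume `M`, every level `k`):
* **`hessian_symm`**; `mixedJet_self_eq_secondJet`, `mixedJetZ_self_eq_secondJetZ`, **`hessian_diag`** (`H(A, A) = ∂²_s|₀`);
* `Pmodel_smul'`, `couplingLetter_negI_add ∕ _smul`, `mixedJetV_add_left ∕ _smul_left`, `mixedJetZ_add_left ∕ _smul_left`, `mixedLetter_add_left ∕ _smul_left` (the letters are linear in `A`),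
  **`hessian_add_left`**, **`hessian_smul_left`**.
WHAT IT DOES NOT DO: the END (PART 254 ∕ PART 247 at `N = 2`); Bałaban's `−∂P∂*` ∕ `aQ(U)*Q(U)` parts and the non-abelian colour structure; base points other than `U = 1`.  SUPPLIER work;
NEVER «G-an2-4 closed»; NOT (CONV-C), NOT D1, NOT `BetaPertH`, NOT continuum, NOT Clay.  Records: `HOME/b2b-balaban-gan24-p3/gen66/README.md`.
-/

noncomputable section

open scoped BigOperators ComplexConjugate Matrix Matrix.Norms.L2Operator
open Filter Topology

namespace Summit.QuantumFields.BalabanUV.Beta.GAN24.ExponentialChartHessianForm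

open Literature.MathematicalPhysics.QuantumFieldTheory.Balaban1983to89
open Literature.MathematicalPhysics.QuantumFieldTheory.Balaban1983to89.B5Prop11Plancherel (Tor fine)
open Literature.MathematicalPhysics.QuantumFieldTheory.Balaban1983to89.B5G183RateUnitTower (lev)
open Summit.QuantumFields.BalabanUV.T4Continuum
open Summit.QuantumFields.BalabanUV.T4Continuum.CovariantAveragingTower (avgTow)
open Summit.QuantumFields.BalabanUV.T4Continuum.BalabanAveragedTowerUnit (idx QBlev calGlev unitCovB)
open Summit.QuantumFields.BalabanUV.T4Continuum.KingPairingPlantedLaw (calDalev)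
open Summit.QuantumFields.BalabanUV.T4Continuum.FirstOrderBackgroundModel (Pmodel)
open Summit.QuantumFields.BalabanUV.T4Continuum.AbelianCovariantLaplacian (covPert)
open Summit.QuantumFields.BalabanUV.Beta.GAN24.BackgroundExpansionTaylor (exists_clm_avgTow)
open Summit.QuantumFields.BalabanUV.Beta.GAN24.CouplingCurveTaylor (Pmodel_apply)
open Summit.QuantumFields.BalabanUV.Beta.GAN24.ExponentialChartMixedBackgrounds (jetV_one_add Pmodel_add' couplingLetter_add)
open Summit.QuantumFields.BalabanUV.Beta.GAN24.ExponentialChartMixedCovariantTaylor (deriv_deriv_invCov_expChart₂_eq_mixedDiagram)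
open Summit.QuantumFields.BalabanUV.Beta.GAN24.ExponentialChartPolarisation (deriv_deriv_invCov_expChart₂_eq_half_polarisation)
open Summit.QuantumFields.BalabanUV.Beta.GAN24.ExponentialChartTower (iteratedDeriv_two_invCov_expChart_eq)

variable {d : ℕ} (L : ℕ) [NeZero L] (M : Fin d → ℕ) [hM : ∀ μ, NeZero (M μ)] (a : ℝ) (ha : 0 < a)

/-! ## The Hessian is a symmetric bilinear form whose diagonal is the second derivative -/

section Form

/-- **`hessian_symm` — SYMMETRY OF THE ONE-LOOP HESSIAN**: `∂_r|₀∂_s|₀F(e^{iη(sA + rB)}) = ∂_r|₀∂_s|₀F(e^{iη(sB + rA)})` — a theorem (no joint differentiability was assumed): both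
      sides are half the
polarisation of PART 247's second derivatives (PART 255), and the chart of `A + B` is the chart of `B + A`. [our proof] -/
theorem hessian_symm (A B : (k : ℕ) → Fin d → (idx L M k → ℝ)) (k : ℕ) :
    deriv (fun r : ℝ => deriv (fun s : ℝ => (avgTow (QBlev L M) ((L : ℝ) ^ d)
          (fun k' => (calDalev L M a ha k' + covPert L M (fun k'' ν' (x' : idx L M k'') => Complex.exp ((Complex.I * ((A k'' ν' x' : ℝ) : ℂ) / ((lev L k'' : ℕ) : ℂ)) * ((s : ℝ) :
                ℂ) + (Complex.I * ((B k'' ν' x' : ℝ) : ℂ) / ((lev L k'' : ℕ) : ℂ)) * ((r : ℝ) : ℂ))) k')⁻¹) k)⁻¹) 0) 0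
      = deriv (fun r : ℝ => deriv (fun s : ℝ => (avgTow (QBlev L M) ((L : ℝ) ^ d)
          (fun k' => (calDalev L M a ha k' + covPert L M (fun k'' ν' (x' : idx L M k'') => Complex.exp ((Complex.I * ((B k'' ν' x' : ℝ) : ℂ) / ((lev L k'' : ℕ) : ℂ)) * ((s : ℝ) :
                ℂ) + (Complex.I * ((A k'' ν' x' : ℝ) : ℂ) / ((lev L k'' : ℕ) : ℂ)) * ((r : ℝ) : ℂ))) k')⁻¹) k)⁻¹) 0) 0 := by
  rw [deriv_deriv_invCov_expChart₂_eq_half_polarisation L M a ha A B k, deriv_deriv_invCov_expChart₂_eq_half_polarisation L M a ha B A k]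
  have e : ∀ s : ℝ, (fun k'' ν' (x' : idx L M k'') => Complex.exp ((Complex.I * ((B k'' ν' x' + A k'' ν' x' : ℝ) : ℂ) / ((lev L k'' : ℕ) : ℂ)) * ((s : ℝ) : ℂ)))
      = (fun k'' ν' (x' : idx L M k'') => Complex.exp ((Complex.I * ((A k'' ν' x' + B k'' ν' x' : ℝ) : ℂ) / ((lev L k'' : ℕ) : ℂ)) * ((s : ℝ) : ℂ))) := fun s => by
    funext k'' ν' x'
    rw [add_comm (B k'' ν' x')]
  simp only [e]
  rw [sub_right_comm]

omit [NeZero L] hM in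
/-- at `B = A` the mixed connection jet is the second connection jet of the chart of `A`: `−(iA)(iA)∕n = −(iA)²∕n`. [folklore] -/
theorem mixedJet_self_eq_secondJet (A : (k : ℕ) → Fin d → (idx L M k → ℝ)) :
    (fun k'' ν' (x' : idx L M k'') => -(Complex.I * ((A k'' ν' x' : ℝ) : ℂ)) * (Complex.I * ((A k'' ν' x' : ℝ) : ℂ) / ((lev L k'' : ℕ) : ℂ)))
      = (fun k'' ν' (x' : idx L M k'') => -((Complex.I * ((A k'' ν' x' : ℝ) : ℂ)) ^ (1 + 1) / ((lev L k'' : ℕ) : ℂ) ^ 1)) := by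
  funext k'' ν' x'
  ring

omit [NeZero L] hM in
/-- at `B = A` the mixed zeroth-order jet is the second zeroth-order jet of the chart of `A`: `−2Σ_ν(iA_ν)(iA_ν) = −Σ_ν((iA_ν)² + (−iA_ν)²)`. [folklore] -/
theorem mixedJetZ_self_eq_secondJetZ (A : (k : ℕ) → Fin d → (idx L M k → ℝ)) :
    (fun (k'' : ℕ) (x' : idx L M k'') => -2 * ∑ ν', (Complex.I * ((A k'' ν' x' : ℝ) : ℂ)) * (Complex.I * ((A k'' ν' x' : ℝ) : ℂ)))
      = (fun (k'' : ℕ) (x' : idx L M k'') => -((∑ ν', ((Complex.I * ((A k'' ν' x' : ℝ) : ℂ)) ^ (0 + 2) + (-(Complex.I * ((A k'' ν' x' : ℝ) : ℂ))) ^ (0 + 2))) / ((lev L k'' : ℕ) :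
            ℂ) ^ 0)) := by
  funext k'' x'
  simp only [pow_zero, div_one, Finset.mul_sum, ← Finset.sum_neg_distrib]
  refine Finset.sum_congr rfl fun ν' _ => ?_
  ring

/-- **`hessian_diag` — THE DIAGONAL OF THE HESSIAN IS PART 247's `N = 2` OBJECT**: `∂_r|₀∂_s|₀F(e^{iη(sA + rA)}) = ∂²_s|₀F(e^{isηA})` (PART 254's five diagrams at `B = A` are PART
      256's three: the
mixed letter at `B = A` is the second letter of the chart of `A`). [our proof] -/
theorem hessian_diag (A : (k : ℕ) → Fin d → (idx L M k → ℝ)) (k : ℕ) :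
    deriv (fun r : ℝ => deriv (fun s : ℝ => (avgTow (QBlev L M) ((L : ℝ) ^ d)
          (fun k' => (calDalev L M a ha k' + covPert L M (fun k'' ν' (x' : idx L M k'') => Complex.exp ((Complex.I * ((A k'' ν' x' : ℝ) : ℂ) / ((lev L k'' : ℕ) : ℂ)) * ((s : ℝ) :
                ℂ) + (Complex.I * ((A k'' ν' x' : ℝ) : ℂ) / ((lev L k'' : ℕ) : ℂ)) * ((r : ℝ) : ℂ))) k')⁻¹) k)⁻¹) 0) 0
      = iteratedDeriv 2 (fun s : ℝ => (avgTow (QBlev L M) ((L : ℝ) ^ d)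
          (fun k' => (calDalev L M a ha k' + covPert L M (fun k'' ν' (x' : idx L M k'') => Complex.exp ((Complex.I * ((A k'' ν' x' : ℝ) : ℂ) / ((lev L k'' : ℕ) : ℂ)) * ((s : ℝ) :
                ℂ))) k')⁻¹) k)⁻¹) 0 := by
  rw [deriv_deriv_invCov_expChart₂_eq_mixedDiagram L M a ha A A k, iteratedDeriv_two_invCov_expChart_eq L M a ha A k, mixedJet_self_eq_secondJet L M A,
    mixedJetZ_self_eq_secondJetZ L M A, two_smul, two_smul]
  abel

/-- the first-order coupling is homogeneous in the background. [folklore] -/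
theorem Pmodel_smul' (c : ℂ) (V : (k : ℕ) → Fin d → (idx L M k → ℂ)) (k : ℕ) :
    Pmodel L M (fun k ν x => c * V k ν x) k = c • Pmodel L M V k := by
  ext i j
  simp only [Matrix.smul_apply, Pmodel_apply, smul_eq_mul, Finset.mul_sum, mul_assoc]

/-- the first letter is additive in the connection: `P(−i(A₁ + A₂)) + P(−i(A₁ + A₂))ᴴ + diag 0 = [A₁] + [A₂]`. [folklore] -/
theorem couplingLetter_negI_add (A₁ A₂ : (k : ℕ) → Fin d → (idx L M k → ℝ)) (k : ℕ) :
    (Pmodel L M (fun k'' ν' (x' : idx L M k'') => -(Complex.I * ((A₁ k'' ν' x' + A₂ k'' ν' x' : ℝ) : ℂ))) k + (Pmodel L M (fun k'' ν' (x' : idx L M k'') => -(Complex.I * ((A₁ k''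
          ν' x' + A₂ k'' ν' x' : ℝ) : ℂ))) k)ᴴ + Matrix.diagonal ((fun (k'' : ℕ) (_ : idx L M k'') => (0 : ℂ)) k))
      = (Pmodel L M (fun k'' ν' (x' : idx L M k'') => -(Complex.I * ((A₁ k'' ν' x' : ℝ) : ℂ))) k + (Pmodel L M (fun k'' ν' (x' : idx L M k'') => -(Complex.I * ((A₁ k'' ν' x' : ℝ)
            : ℂ))) k)ᴴ + Matrix.diagonal ((fun (k'' : ℕ) (_ : idx L M k'') => (0 : ℂ)) k))
        + (Pmodel L M (fun k'' ν' (x' : idx L M k'') => -(Complex.I * ((A₂ k'' ν' x' : ℝ) : ℂ))) k + (Pmodel L M (fun k'' ν' (x' : idx L M k'') => -(Complex.I * ((A₂ k'' ν' x' :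
              ℝ) : ℂ))) k)ᴴ + Matrix.diagonal ((fun (k'' : ℕ) (_ : idx L M k'') => (0 : ℂ)) k)) := by
  have dz : Matrix.diagonal ((fun (k'' : ℕ) (_ : idx L M k'') => (0 : ℂ)) k) = 0 := Matrix.diagonal_zero
  rw [jetV_one_add L M A₁ A₂, Pmodel_add', Matrix.conjTranspose_add, dz]
  abel

/-- the first letter is homogeneous in the connection: `P(−i(cA)) + P(−i(cA))ᴴ + diag 0 = c·[A]` for real `c`. [folklore] -/
theorem couplingLetter_negI_smul (c : ℝ) (A : (k : ℕ) → Fin d → (idx L M k → ℝ)) (k : ℕ) :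
    (Pmodel L M (fun k'' ν' (x' : idx L M k'') => -(Complex.I * ((c * A k'' ν' x' : ℝ) : ℂ))) k + (Pmodel L M (fun k'' ν' (x' : idx L M k'') => -(Complex.I * ((c * A k'' ν' x' :
          ℝ) : ℂ))) k)ᴴ + Matrix.diagonal ((fun (k'' : ℕ) (_ : idx L M k'') => (0 : ℂ)) k))
      = (c : ℂ) • (Pmodel L M (fun k'' ν' (x' : idx L M k'') => -(Complex.I * ((A k'' ν' x' : ℝ) : ℂ))) k + (Pmodel L M (fun k'' ν' (x' : idx L M k'') => -(Complex.I * ((A k'' ν'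
            x' : ℝ) : ℂ))) k)ᴴ + Matrix.diagonal ((fun (k'' : ℕ) (_ : idx L M k'') => (0 : ℂ)) k)) := by
  have dz : Matrix.diagonal ((fun (k'' : ℕ) (_ : idx L M k'') => (0 : ℂ)) k) = 0 := Matrix.diagonal_zero
  have e : (fun k'' ν' (x' : idx L M k'') => -(Complex.I * ((c * A k'' ν' x' : ℝ) : ℂ)))
      = fun k'' ν' (x' : idx L M k'') => (c : ℂ) * -(Complex.I * ((A k'' ν' x' : ℝ) : ℂ)) := by
    funext k'' ν' x'
    push_cast
    ring
  have hs : star (c : ℂ) = (c : ℂ) := by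
    rw [Complex.star_def, Complex.conj_ofReal]
  rw [e, Pmodel_smul', Matrix.conjTranspose_smul, hs, dz, add_zero, add_zero, smul_add]

omit [NeZero L] hM in
/-- the mixed connection jet is additive in `A`. [folklore] -/
theorem mixedJetV_add_left (A₁ A₂ B : (k : ℕ) → Fin d → (idx L M k → ℝ)) :
    (fun k'' ν' (x' : idx L M k'') => -(Complex.I * ((A₁ k'' ν' x' + A₂ k'' ν' x' : ℝ) : ℂ)) * (Complex.I * ((B k'' ν' x' : ℝ) : ℂ) / ((lev L k'' : ℕ) : ℂ)))
      = fun k'' ν' (x' : idx L M k'') => (fun k'' ν' (x' : idx L M k'') => -(Complex.I * ((A₁ k'' ν' x' : ℝ) : ℂ)) * (Complex.I * ((B k'' ν' x' : ℝ) : ℂ) / ((lev L k'' : ℕ) : ℂ)))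
            k'' ν' x'
          + (fun k'' ν' (x' : idx L M k'') => -(Complex.I * ((A₂ k'' ν' x' : ℝ) : ℂ)) * (Complex.I * ((B k'' ν' x' : ℝ) : ℂ) / ((lev L k'' : ℕ) : ℂ))) k'' ν' x' := by
  funext k'' ν' x'
  push_cast
  ring

omit [NeZero L] hM in
/-- the mixed zeroth-order jet is additive in `A`. [folklore] -/
theorem mixedJetZ_add_left (A₁ A₂ B : (k : ℕ) → Fin d → (idx L M k → ℝ)) (k : ℕ) :
    (fun (k'' : ℕ) (x' : idx L M k'') => -2 * ∑ ν', (Complex.I * ((A₁ k'' ν' x' + A₂ k'' ν' x' : ℝ) : ℂ)) * (Complex.I * ((B k'' ν' x' : ℝ) : ℂ))) k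
      = fun (x' : idx L M k) => (fun (k'' : ℕ) (x' : idx L M k'') => -2 * ∑ ν', (Complex.I * ((A₁ k'' ν' x' : ℝ) : ℂ)) * (Complex.I * ((B k'' ν' x' : ℝ) : ℂ))) k x' + (fun (k'' :
            ℕ) (x' : idx L M k'') => -2 * ∑ ν', (Complex.I * ((A₂ k'' ν' x' : ℝ) : ℂ)) * (Complex.I * ((B k'' ν' x' : ℝ) : ℂ))) k x' := by
  funext x'
  simp only [Finset.mul_sum, ← Finset.sum_add_distrib]
  refine Finset.sum_congr rfl fun ν' _ => ?_
  push_cast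
  ring

/-- the mixed letter is additive in `A`. [folklore] -/
theorem mixedLetter_add_left (A₁ A₂ B : (k : ℕ) → Fin d → (idx L M k → ℝ)) (k : ℕ) :
    (Pmodel L M (fun k'' ν' (x' : idx L M k'') => -(Complex.I * ((A₁ k'' ν' x' + A₂ k'' ν' x' : ℝ) : ℂ)) * (Complex.I * ((B k'' ν' x' : ℝ) : ℂ) / ((lev L k'' : ℕ) : ℂ))) k +
          (Pmodel L M (fun k'' ν' (x' : idx L M k'') => -(Complex.I * ((A₁ k'' ν' x' + A₂ k'' ν' x' : ℝ) : ℂ)) * (Complex.I * ((B k'' ν' x' : ℝ) : ℂ) / ((lev L k'' : ℕ) : ℂ))) k)ᴴ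
          + Matrix.diagonal ((fun (k'' : ℕ) (x' : idx L M k'') => -2 * ∑ ν', (Complex.I * ((A₁ k'' ν' x' + A₂ k'' ν' x' : ℝ) : ℂ)) * (Complex.I * ((B k'' ν' x' : ℝ) : ℂ))) k))
      = (Pmodel L M (fun k'' ν' (x' : idx L M k'') => -(Complex.I * ((A₁ k'' ν' x' : ℝ) : ℂ)) * (Complex.I * ((B k'' ν' x' : ℝ) : ℂ) / ((lev L k'' : ℕ) : ℂ))) k + (Pmodel L M (fun
            k'' ν' (x' : idx L M k'') => -(Complex.I * ((A₁ k'' ν' x' : ℝ) : ℂ)) * (Complex.I * ((B k'' ν' x' : ℝ) : ℂ) / ((lev L k'' : ℕ) : ℂ))) k)ᴴ + Matrix.diagonal ((fun (k''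
            : ℕ) (x' : idx L M k'') => -2 * ∑ ν', (Complex.I * ((A₁ k'' ν' x' : ℝ) : ℂ)) * (Complex.I * ((B k'' ν' x' : ℝ) : ℂ))) k))
        + (Pmodel L M (fun k'' ν' (x' : idx L M k'') => -(Complex.I * ((A₂ k'' ν' x' : ℝ) : ℂ)) * (Complex.I * ((B k'' ν' x' : ℝ) : ℂ) / ((lev L k'' : ℕ) : ℂ))) k + (Pmodel L M
              (fun k'' ν' (x' : idx L M k'') => -(Complex.I * ((A₂ k'' ν' x' : ℝ) : ℂ)) * (Complex.I * ((B k'' ν' x' : ℝ) : ℂ) / ((lev L k'' : ℕ) : ℂ))) k)ᴴ + Matrix.diagonal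
              ((fun (k'' : ℕ) (x' : idx L M k'') => -2 * ∑ ν', (Complex.I * ((A₂ k'' ν' x' : ℝ) : ℂ)) * (Complex.I * ((B k'' ν' x' : ℝ) : ℂ))) k)) := by
  rw [mixedJetV_add_left L M A₁ A₂ B, mixedJetZ_add_left L M A₁ A₂ B k]
  exact couplingLetter_add L M (fun k'' ν' (x' : idx L M k'') => -(Complex.I * ((A₁ k'' ν' x' : ℝ) : ℂ)) * (Complex.I * ((B k'' ν' x' : ℝ) : ℂ) / ((lev L k'' : ℕ) : ℂ)))
    (fun k'' ν' (x' : idx L M k'') => -(Complex.I * ((A₂ k'' ν' x' : ℝ) : ℂ)) * (Complex.I * ((B k'' ν' x' : ℝ) : ℂ) / ((lev L k'' : ℕ) : ℂ)))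
    (fun (k'' : ℕ) (x' : idx L M k'') => -2 * ∑ ν', (Complex.I * ((A₁ k'' ν' x' : ℝ) : ℂ)) * (Complex.I * ((B k'' ν' x' : ℝ) : ℂ)))
    (fun (k'' : ℕ) (x' : idx L M k'') => -2 * ∑ ν', (Complex.I * ((A₂ k'' ν' x' : ℝ) : ℂ)) * (Complex.I * ((B k'' ν' x' : ℝ) : ℂ))) k

omit [NeZero L] hM in
/-- the mixed connection jet is homogeneous in `A`. [folklore] -/
theorem mixedJetV_smul_left (c : ℝ) (A B : (k : ℕ) → Fin d → (idx L M k → ℝ)) :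
    (fun k'' ν' (x' : idx L M k'') => -(Complex.I * ((c * A k'' ν' x' : ℝ) : ℂ)) * (Complex.I * ((B k'' ν' x' : ℝ) : ℂ) / ((lev L k'' : ℕ) : ℂ)))
      = fun k'' ν' (x' : idx L M k'') => (c : ℂ) * (fun k'' ν' (x' : idx L M k'') => -(Complex.I * ((A k'' ν' x' : ℝ) : ℂ)) * (Complex.I * ((B k'' ν' x' : ℝ) : ℂ) / ((lev L k'' :
            ℕ) : ℂ))) k'' ν' x' := by
  funext k'' ν' x'
  push_cast
  ring

omit [NeZero L] hM in
/-- the mixed zeroth-order jet is homogeneous in `A`. [folklore] -/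
theorem mixedJetZ_smul_left (c : ℝ) (A B : (k : ℕ) → Fin d → (idx L M k → ℝ)) (k : ℕ) :
    (fun (k'' : ℕ) (x' : idx L M k'') => -2 * ∑ ν', (Complex.I * ((c * A k'' ν' x' : ℝ) : ℂ)) * (Complex.I * ((B k'' ν' x' : ℝ) : ℂ))) k
      = fun (x' : idx L M k) => (c : ℂ) * (fun (k'' : ℕ) (x' : idx L M k'') => -2 * ∑ ν', (Complex.I * ((A k'' ν' x' : ℝ) : ℂ)) * (Complex.I * ((B k'' ν' x' : ℝ) : ℂ))) k x' := by
  funext x'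
  simp only [Finset.mul_sum]
  refine Finset.sum_congr rfl fun ν' _ => ?_
  push_cast
  ring

/-- the mixed letter is homogeneous in `A` (real `c`: `star c = c`). [folklore] -/
theorem mixedLetter_smul_left (c : ℝ) (A B : (k : ℕ) → Fin d → (idx L M k → ℝ)) (k : ℕ) :
    (Pmodel L M (fun k'' ν' (x' : idx L M k'') => -(Complex.I * ((c * A k'' ν' x' : ℝ) : ℂ)) * (Complex.I * ((B k'' ν' x' : ℝ) : ℂ) / ((lev L k'' : ℕ) : ℂ))) k + (Pmodel L M (fun
          k'' ν' (x' : idx L M k'') => -(Complex.I * ((c * A k'' ν' x' : ℝ) : ℂ)) * (Complex.I * ((B k'' ν' x' : ℝ) : ℂ) / ((lev L k'' : ℕ) : ℂ))) k)ᴴ + Matrix.diagonal ((fun (k''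
          : ℕ) (x' : idx L M k'') => -2 * ∑ ν', (Complex.I * ((c * A k'' ν' x' : ℝ) : ℂ)) * (Complex.I * ((B k'' ν' x' : ℝ) : ℂ))) k))
      = (c : ℂ) • (Pmodel L M (fun k'' ν' (x' : idx L M k'') => -(Complex.I * ((A k'' ν' x' : ℝ) : ℂ)) * (Complex.I * ((B k'' ν' x' : ℝ) : ℂ) / ((lev L k'' : ℕ) : ℂ))) k + (Pmodel
            L M (fun k'' ν' (x' : idx L M k'') => -(Complex.I * ((A k'' ν' x' : ℝ) : ℂ)) * (Complex.I * ((B k'' ν' x' : ℝ) : ℂ) / ((lev L k'' : ℕ) : ℂ))) k)ᴴ + Matrix.diagonal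
            ((fun (k'' : ℕ) (x' : idx L M k'') => -2 * ∑ ν', (Complex.I * ((A k'' ν' x' : ℝ) : ℂ)) * (Complex.I * ((B k'' ν' x' : ℝ) : ℂ))) k)) := by
  have hs : star (c : ℂ) = (c : ℂ) := by
    rw [Complex.star_def, Complex.conj_ofReal]
  have hd : (fun (x' : idx L M k) => (c : ℂ) * (fun (k'' : ℕ) (x' : idx L M k'') => -2 * ∑ ν', (Complex.I * ((A k'' ν' x' : ℝ) : ℂ)) * (Complex.I * ((B k'' ν' x' : ℝ) : ℂ))) k x')
      = (c : ℂ) • ((fun (k'' : ℕ) (x' : idx L M k'') => -2 * ∑ ν', (Complex.I * ((A k'' ν' x' : ℝ) : ℂ)) * (Complex.I * ((B k'' ν' x' : ℝ) : ℂ))) k) := by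
    funext x'
    simp only [Pi.smul_apply, smul_eq_mul]
  rw [mixedJetV_smul_left L M c A B, mixedJetZ_smul_left L M c A B k, Pmodel_smul', Matrix.conjTranspose_smul, hs, hd, Matrix.diagonal_smul, smul_add, smul_add]

/-- **`hessian_add_left` — THE HESSIAN IS ADDITIVE IN ITS FIRST ARGUMENT**: `H(A₁ + A₂, B) = H(A₁, B) + H(A₂, B)` (PART 254's five diagrams; the letters are additive in `A`, the
      read-out
`X ↦ L^{dk}Q_kXQ_kᴴ` is linear). [our proof] -/
theorem hessian_add_left (A₁ A₂ B : (k : ℕ) → Fin d → (idx L M k → ℝ)) (k : ℕ) :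
    deriv (fun r : ℝ => deriv (fun s : ℝ => (avgTow (QBlev L M) ((L : ℝ) ^ d)
          (fun k' => (calDalev L M a ha k' + covPert L M (fun k'' ν' (x' : idx L M k'') => Complex.exp ((Complex.I * ((A₁ k'' ν' x' + A₂ k'' ν' x' : ℝ) : ℂ) / ((lev L k'' : ℕ) :
                ℂ)) * ((s : ℝ) : ℂ) + (Complex.I * ((B k'' ν' x' : ℝ) : ℂ) / ((lev L k'' : ℕ) : ℂ)) * ((r : ℝ) : ℂ))) k')⁻¹) k)⁻¹) 0) 0
      = deriv (fun r : ℝ => deriv (fun s : ℝ => (avgTow (QBlev L M) ((L : ℝ) ^ d)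
          (fun k' => (calDalev L M a ha k' + covPert L M (fun k'' ν' (x' : idx L M k'') => Complex.exp ((Complex.I * ((A₁ k'' ν' x' : ℝ) : ℂ) / ((lev L k'' : ℕ) : ℂ)) * ((s : ℝ) :
                ℂ) + (Complex.I * ((B k'' ν' x' : ℝ) : ℂ) / ((lev L k'' : ℕ) : ℂ)) * ((r : ℝ) : ℂ))) k')⁻¹) k)⁻¹) 0) 0
        + deriv (fun r : ℝ => deriv (fun s : ℝ => (avgTow (QBlev L M) ((L : ℝ) ^ d)
          (fun k' => (calDalev L M a ha k' + covPert L M (fun k'' ν' (x' : idx L M k'') => Complex.exp ((Complex.I * ((A₂ k'' ν' x' : ℝ) : ℂ) / ((lev L k'' : ℕ) : ℂ)) * ((s : ℝ) :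
                ℂ) + (Complex.I * ((B k'' ν' x' : ℝ) : ℂ) / ((lev L k'' : ℕ) : ℂ)) * ((r : ℝ) : ℂ))) k')⁻¹) k)⁻¹) 0) 0 := by
  have h12 : deriv (fun r : ℝ => deriv (fun s : ℝ => (avgTow (QBlev L M) ((L : ℝ) ^ d)
          (fun k' => (calDalev L M a ha k' + covPert L M (fun k'' ν' (x' : idx L M k'') => Complex.exp ((Complex.I * ((A₁ k'' ν' x' + A₂ k'' ν' x' : ℝ) : ℂ) / ((lev L k'' : ℕ) :
                ℂ)) * ((s : ℝ) : ℂ) + (Complex.I * ((B k'' ν' x' : ℝ) : ℂ) / ((lev L k'' : ℕ) : ℂ)) * ((r : ℝ) : ℂ))) k')⁻¹) k)⁻¹) 0) 0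
      =
      (unitCovB L M a ha k)⁻¹ * avgTow (QBlev L M) ((L : ℝ) ^ d) (fun k' => calGlev L M a ha k' * (Pmodel L M (fun k'' ν' (x' : idx L M k'') => -(Complex.I * ((B k'' ν' x' : ℝ) :
            ℂ))) k' + (Pmodel L M (fun k'' ν' (x' : idx L M k'') => -(Complex.I * ((B k'' ν' x' : ℝ) : ℂ))) k')ᴴ + Matrix.diagonal ((fun (k'' : ℕ) (_ : idx L M k'') => (0 : ℂ))
            k')) * calGlev L M a ha k') k
          * (unitCovB L M a ha k)⁻¹ * avgTow (QBlev L M) ((L : ℝ) ^ d) (fun k' => calGlev L M a ha k' * (Pmodel L M (fun k'' ν' (x' : idx L M k'') => -(Complex.I * ((A₁ k'' ν' x'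
                + A₂ k'' ν' x' : ℝ) : ℂ))) k' + (Pmodel L M (fun k'' ν' (x' : idx L M k'') => -(Complex.I * ((A₁ k'' ν' x' + A₂ k'' ν' x' : ℝ) : ℂ))) k')ᴴ + Matrix.diagonal ((fun
                (k'' : ℕ) (_ : idx L M k'') => (0 : ℂ)) k')) * calGlev L M a ha k') k
          * (unitCovB L M a ha k)⁻¹
        + (unitCovB L M a ha k)⁻¹ * avgTow (QBlev L M) ((L : ℝ) ^ d) (fun k' => calGlev L M a ha k' * (Pmodel L M (fun k'' ν' (x' : idx L M k'') => -(Complex.I * ((A₁ k'' ν' x' +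
              A₂ k'' ν' x' : ℝ) : ℂ))) k' + (Pmodel L M (fun k'' ν' (x' : idx L M k'') => -(Complex.I * ((A₁ k'' ν' x' + A₂ k'' ν' x' : ℝ) : ℂ))) k')ᴴ + Matrix.diagonal ((fun (k''
              : ℕ) (_ : idx L M k'') => (0 : ℂ)) k')) * calGlev L M a ha k') k
          * (unitCovB L M a ha k)⁻¹ * avgTow (QBlev L M) ((L : ℝ) ^ d) (fun k' => calGlev L M a ha k' * (Pmodel L M (fun k'' ν' (x' : idx L M k'') => -(Complex.I * ((B k'' ν' x' :
                ℝ) : ℂ))) k' + (Pmodel L M (fun k'' ν' (x' : idx L M k'') => -(Complex.I * ((B k'' ν' x' : ℝ) : ℂ))) k')ᴴ + Matrix.diagonal ((fun (k'' : ℕ) (_ : idx L M k'') => (0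
                : ℂ)) k')) * calGlev L M a ha k') k
          * (unitCovB L M a ha k)⁻¹
        - (unitCovB L M a ha k)⁻¹ * avgTow (QBlev L M) ((L : ℝ) ^ d) (fun k' => calGlev L M a ha k' * (Pmodel L M (fun k'' ν' (x' : idx L M k'') => -(Complex.I * ((B k'' ν' x' :
              ℝ) : ℂ))) k' + (Pmodel L M (fun k'' ν' (x' : idx L M k'') => -(Complex.I * ((B k'' ν' x' : ℝ) : ℂ))) k')ᴴ + Matrix.diagonal ((fun (k'' : ℕ) (_ : idx L M k'') => (0 :
              ℂ)) k')) * (calGlev L M a ha k' * (Pmodel L M (fun k'' ν' (x' : idx L M k'') => -(Complex.I * ((A₁ k'' ν' x' + A₂ k'' ν' x' : ℝ) : ℂ))) k' + (Pmodel L M (fun k'' ν'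
              (x' : idx L M k'') => -(Complex.I * ((A₁ k'' ν' x' + A₂ k'' ν' x' : ℝ) : ℂ))) k')ᴴ + Matrix.diagonal ((fun (k'' : ℕ) (_ : idx L M k'') => (0 : ℂ)) k')) * calGlev L M
              a ha k')) k
          * (unitCovB L M a ha k)⁻¹
        - (unitCovB L M a ha k)⁻¹ * avgTow (QBlev L M) ((L : ℝ) ^ d) (fun k' => calGlev L M a ha k' * (Pmodel L M (fun k'' ν' (x' : idx L M k'') => -(Complex.I * ((A₁ k'' ν' x' +
              A₂ k'' ν' x' : ℝ) : ℂ))) k' + (Pmodel L M (fun k'' ν' (x' : idx L M k'') => -(Complex.I * ((A₁ k'' ν' x' + A₂ k'' ν' x' : ℝ) : ℂ))) k')ᴴ + Matrix.diagonal ((fun (k''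
              : ℕ) (_ : idx L M k'') => (0 : ℂ)) k')) * (calGlev L M a ha k' * (Pmodel L M (fun k'' ν' (x' : idx L M k'') => -(Complex.I * ((B k'' ν' x' : ℝ) : ℂ))) k' + (Pmodel L
              M (fun k'' ν' (x' : idx L M k'') => -(Complex.I * ((B k'' ν' x' : ℝ) : ℂ))) k')ᴴ + Matrix.diagonal ((fun (k'' : ℕ) (_ : idx L M k'') => (0 : ℂ)) k')) * calGlev L M a
              ha k')) k
          * (unitCovB L M a ha k)⁻¹
        + (unitCovB L M a ha k)⁻¹ * avgTow (QBlev L M) ((L : ℝ) ^ d) (fun k' => calGlev L M a ha k' * (Pmodel L M (fun k'' ν' (x' : idx L M k'') => -(Complex.I * ((A₁ k'' ν' x' +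
              A₂ k'' ν' x' : ℝ) : ℂ)) * (Complex.I * ((B k'' ν' x' : ℝ) : ℂ) / ((lev L k'' : ℕ) : ℂ))) k' + (Pmodel L M (fun k'' ν' (x' : idx L M k'') => -(Complex.I * ((A₁ k'' ν'
              x' + A₂ k'' ν' x' : ℝ) : ℂ)) * (Complex.I * ((B k'' ν' x' : ℝ) : ℂ) / ((lev L k'' : ℕ) : ℂ))) k')ᴴ + Matrix.diagonal ((fun (k'' : ℕ) (x' : idx L M k'') => -2 * ∑ ν',
              (Complex.I * ((A₁ k'' ν' x' + A₂ k'' ν' x' : ℝ) : ℂ)) * (Complex.I * ((B k'' ν' x' : ℝ) : ℂ))) k')) * calGlev L M a ha k') k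
          * (unitCovB L M a ha k)⁻¹ :=
    deriv_deriv_invCov_expChart₂_eq_mixedDiagram L M a ha (fun k ν x => A₁ k ν x + A₂ k ν x) B k
  rw [h12, deriv_deriv_invCov_expChart₂_eq_mixedDiagram L M a ha A₁ B k, deriv_deriv_invCov_expChart₂_eq_mixedDiagram L M a ha A₂ B k]
  obtain ⟨Φ, hΦ⟩ := exists_clm_avgTow (QBlev L M) ((L : ℝ) ^ d) k
  simp only [hΦ]
  rw [couplingLetter_negI_add L M A₁ A₂ k, mixedLetter_add_left L M A₁ A₂ B k]
  simp only [Matrix.mul_add, Matrix.add_mul, map_add]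
  abel

/-- **`hessian_smul_left` — THE HESSIAN IS HOMOGENEOUS IN ITS FIRST ARGUMENT**: `H(cA, B) = c·H(A, B)` for real `c`. [our proof] -/
theorem hessian_smul_left (c : ℝ) (A B : (k : ℕ) → Fin d → (idx L M k → ℝ)) (k : ℕ) :
    deriv (fun r : ℝ => deriv (fun s : ℝ => (avgTow (QBlev L M) ((L : ℝ) ^ d)
          (fun k' => (calDalev L M a ha k' + covPert L M (fun k'' ν' (x' : idx L M k'') => Complex.exp ((Complex.I * ((c * A k'' ν' x' : ℝ) : ℂ) / ((lev L k'' : ℕ) : ℂ)) * ((s :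
                ℝ) : ℂ) + (Complex.I * ((B k'' ν' x' : ℝ) : ℂ) / ((lev L k'' : ℕ) : ℂ)) * ((r : ℝ) : ℂ))) k')⁻¹) k)⁻¹) 0) 0
      = (c : ℂ) • deriv (fun r : ℝ => deriv (fun s : ℝ => (avgTow (QBlev L M) ((L : ℝ) ^ d)
          (fun k' => (calDalev L M a ha k' + covPert L M (fun k'' ν' (x' : idx L M k'') => Complex.exp ((Complex.I * ((A k'' ν' x' : ℝ) : ℂ) / ((lev L k'' : ℕ) : ℂ)) * ((s : ℝ) :
                ℂ) + (Complex.I * ((B k'' ν' x' : ℝ) : ℂ) / ((lev L k'' : ℕ) : ℂ)) * ((r : ℝ) : ℂ))) k')⁻¹) k)⁻¹) 0) 0 := by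
  have hc : deriv (fun r : ℝ => deriv (fun s : ℝ => (avgTow (QBlev L M) ((L : ℝ) ^ d)
          (fun k' => (calDalev L M a ha k' + covPert L M (fun k'' ν' (x' : idx L M k'') => Complex.exp ((Complex.I * ((c * A k'' ν' x' : ℝ) : ℂ) / ((lev L k'' : ℕ) : ℂ)) * ((s :
                ℝ) : ℂ) + (Complex.I * ((B k'' ν' x' : ℝ) : ℂ) / ((lev L k'' : ℕ) : ℂ)) * ((r : ℝ) : ℂ))) k')⁻¹) k)⁻¹) 0) 0
      =
      (unitCovB L M a ha k)⁻¹ * avgTow (QBlev L M) ((L : ℝ) ^ d) (fun k' => calGlev L M a ha k' * (Pmodel L M (fun k'' ν' (x' : idx L M k'') => -(Complex.I * ((B k'' ν' x' : ℝ) :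
            ℂ))) k' + (Pmodel L M (fun k'' ν' (x' : idx L M k'') => -(Complex.I * ((B k'' ν' x' : ℝ) : ℂ))) k')ᴴ + Matrix.diagonal ((fun (k'' : ℕ) (_ : idx L M k'') => (0 : ℂ))
            k')) * calGlev L M a ha k') k
          * (unitCovB L M a ha k)⁻¹ * avgTow (QBlev L M) ((L : ℝ) ^ d) (fun k' => calGlev L M a ha k' * (Pmodel L M (fun k'' ν' (x' : idx L M k'') => -(Complex.I * ((c * A k'' ν'
                x' : ℝ) : ℂ))) k' + (Pmodel L M (fun k'' ν' (x' : idx L M k'') => -(Complex.I * ((c * A k'' ν' x' : ℝ) : ℂ))) k')ᴴ + Matrix.diagonal ((fun (k'' : ℕ) (_ : idx L M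
                k'') => (0 : ℂ)) k')) * calGlev L M a ha k') k
          * (unitCovB L M a ha k)⁻¹
        + (unitCovB L M a ha k)⁻¹ * avgTow (QBlev L M) ((L : ℝ) ^ d) (fun k' => calGlev L M a ha k' * (Pmodel L M (fun k'' ν' (x' : idx L M k'') => -(Complex.I * ((c * A k'' ν' x'
              : ℝ) : ℂ))) k' + (Pmodel L M (fun k'' ν' (x' : idx L M k'') => -(Complex.I * ((c * A k'' ν' x' : ℝ) : ℂ))) k')ᴴ + Matrix.diagonal ((fun (k'' : ℕ) (_ : idx L M k'')
              => (0 : ℂ)) k')) * calGlev L M a ha k') k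
          * (unitCovB L M a ha k)⁻¹ * avgTow (QBlev L M) ((L : ℝ) ^ d) (fun k' => calGlev L M a ha k' * (Pmodel L M (fun k'' ν' (x' : idx L M k'') => -(Complex.I * ((B k'' ν' x' :
                ℝ) : ℂ))) k' + (Pmodel L M (fun k'' ν' (x' : idx L M k'') => -(Complex.I * ((B k'' ν' x' : ℝ) : ℂ))) k')ᴴ + Matrix.diagonal ((fun (k'' : ℕ) (_ : idx L M k'') => (0
                : ℂ)) k')) * calGlev L M a ha k') k
          * (unitCovB L M a ha k)⁻¹
        - (unitCovB L M a ha k)⁻¹ * avgTow (QBlev L M) ((L : ℝ) ^ d) (fun k' => calGlev L M a ha k' * (Pmodel L M (fun k'' ν' (x' : idx L M k'') => -(Complex.I * ((B k'' ν' x' :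
              ℝ) : ℂ))) k' + (Pmodel L M (fun k'' ν' (x' : idx L M k'') => -(Complex.I * ((B k'' ν' x' : ℝ) : ℂ))) k')ᴴ + Matrix.diagonal ((fun (k'' : ℕ) (_ : idx L M k'') => (0 :
              ℂ)) k')) * (calGlev L M a ha k' * (Pmodel L M (fun k'' ν' (x' : idx L M k'') => -(Complex.I * ((c * A k'' ν' x' : ℝ) : ℂ))) k' + (Pmodel L M (fun k'' ν' (x' : idx L
              M k'') => -(Complex.I * ((c * A k'' ν' x' : ℝ) : ℂ))) k')ᴴ + Matrix.diagonal ((fun (k'' : ℕ) (_ : idx L M k'') => (0 : ℂ)) k')) * calGlev L M a ha k')) k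
          * (unitCovB L M a ha k)⁻¹
        - (unitCovB L M a ha k)⁻¹ * avgTow (QBlev L M) ((L : ℝ) ^ d) (fun k' => calGlev L M a ha k' * (Pmodel L M (fun k'' ν' (x' : idx L M k'') => -(Complex.I * ((c * A k'' ν' x'
              : ℝ) : ℂ))) k' + (Pmodel L M (fun k'' ν' (x' : idx L M k'') => -(Complex.I * ((c * A k'' ν' x' : ℝ) : ℂ))) k')ᴴ + Matrix.diagonal ((fun (k'' : ℕ) (_ : idx L M k'')
              => (0 : ℂ)) k')) * (calGlev L M a ha k' * (Pmodel L M (fun k'' ν' (x' : idx L M k'') => -(Complex.I * ((B k'' ν' x' : ℝ) : ℂ))) k' + (Pmodel L M (fun k'' ν' (x' :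
              idx L M k'') => -(Complex.I * ((B k'' ν' x' : ℝ) : ℂ))) k')ᴴ + Matrix.diagonal ((fun (k'' : ℕ) (_ : idx L M k'') => (0 : ℂ)) k')) * calGlev L M a ha k')) k
          * (unitCovB L M a ha k)⁻¹
        + (unitCovB L M a ha k)⁻¹ * avgTow (QBlev L M) ((L : ℝ) ^ d) (fun k' => calGlev L M a ha k' * (Pmodel L M (fun k'' ν' (x' : idx L M k'') => -(Complex.I * ((c * A k'' ν' x'
              : ℝ) : ℂ)) * (Complex.I * ((B k'' ν' x' : ℝ) : ℂ) / ((lev L k'' : ℕ) : ℂ))) k' + (Pmodel L M (fun k'' ν' (x' : idx L M k'') => -(Complex.I * ((c * A k'' ν' x' : ℝ) :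
              ℂ)) * (Complex.I * ((B k'' ν' x' : ℝ) : ℂ) / ((lev L k'' : ℕ) : ℂ))) k')ᴴ + Matrix.diagonal ((fun (k'' : ℕ) (x' : idx L M k'') => -2 * ∑ ν', (Complex.I * ((c * A k''
              ν' x' : ℝ) : ℂ)) * (Complex.I * ((B k'' ν' x' : ℝ) : ℂ))) k')) * calGlev L M a ha k') k
          * (unitCovB L M a ha k)⁻¹ :=
    deriv_deriv_invCov_expChart₂_eq_mixedDiagram L M a ha (fun k ν x => c * A k ν x) B k
  rw [hc, deriv_deriv_invCov_expChart₂_eq_mixedDiagram L M a ha A B k]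
  obtain ⟨Φ, hΦ⟩ := exists_clm_avgTow (QBlev L M) ((L : ℝ) ^ d) k
  simp only [hΦ]
  rw [couplingLetter_negI_smul L M c A k, mixedLetter_smul_left L M c A B k]
  simp only [Matrix.mul_smul, Matrix.smul_mul, map_smul]
  simp only [smul_add, smul_sub]


/-! ### v2 (gen 66, append-only): linearity in the SECOND argument by symmetry — `H` is a symmetric bilinear form -/

/-- **`hessian_add_right` — THE HESSIAN IS ADDITIVE IN ITS SECOND ARGUMENT** (symmetry + `hessian_add_left`): the one-loop Hessian is a symmetric BILINEAR form. [our proof] -/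
theorem hessian_add_right (A B₁ B₂ : (k : ℕ) → Fin d → (idx L M k → ℝ)) (k : ℕ) :
    deriv (fun r : ℝ => deriv (fun s : ℝ => (avgTow (QBlev L M) ((L : ℝ) ^ d)
          (fun k' => (calDalev L M a ha k' + covPert L M (fun k'' ν' (x' : idx L M k'') => Complex.exp ((Complex.I * ((A k'' ν' x' : ℝ) : ℂ) / ((lev L k'' : ℕ) : ℂ)) * ((s : ℝ) :
                ℂ) + (Complex.I * ((B₁ k'' ν' x' + B₂ k'' ν' x' : ℝ) : ℂ) / ((lev L k'' : ℕ) : ℂ)) * ((r : ℝ) : ℂ))) k')⁻¹) k)⁻¹) 0) 0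
      = deriv (fun r : ℝ => deriv (fun s : ℝ => (avgTow (QBlev L M) ((L : ℝ) ^ d)
          (fun k' => (calDalev L M a ha k' + covPert L M (fun k'' ν' (x' : idx L M k'') => Complex.exp ((Complex.I * ((A k'' ν' x' : ℝ) : ℂ) / ((lev L k'' : ℕ) : ℂ)) * ((s : ℝ) :
                ℂ) + (Complex.I * ((B₁ k'' ν' x' : ℝ) : ℂ) / ((lev L k'' : ℕ) : ℂ)) * ((r : ℝ) : ℂ))) k')⁻¹) k)⁻¹) 0) 0
        + deriv (fun r : ℝ => deriv (fun s : ℝ => (avgTow (QBlev L M) ((L : ℝ) ^ d)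
          (fun k' => (calDalev L M a ha k' + covPert L M (fun k'' ν' (x' : idx L M k'') => Complex.exp ((Complex.I * ((A k'' ν' x' : ℝ) : ℂ) / ((lev L k'' : ℕ) : ℂ)) * ((s : ℝ) :
                ℂ) + (Complex.I * ((B₂ k'' ν' x' : ℝ) : ℂ) / ((lev L k'' : ℕ) : ℂ)) * ((r : ℝ) : ℂ))) k')⁻¹) k)⁻¹) 0) 0 := by
  have e1 : deriv (fun r : ℝ => deriv (fun s : ℝ => (avgTow (QBlev L M) ((L : ℝ) ^ d)
          (fun k' => (calDalev L M a ha k' + covPert L M (fun k'' ν' (x' : idx L M k'') => Complex.exp ((Complex.I * ((A k'' ν' x' : ℝ) : ℂ) / ((lev L k'' : ℕ) : ℂ)) * ((s : ℝ) :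
                ℂ) + (Complex.I * ((B₁ k'' ν' x' + B₂ k'' ν' x' : ℝ) : ℂ) / ((lev L k'' : ℕ) : ℂ)) * ((r : ℝ) : ℂ))) k')⁻¹) k)⁻¹) 0) 0
      = deriv (fun r : ℝ => deriv (fun s : ℝ => (avgTow (QBlev L M) ((L : ℝ) ^ d)
          (fun k' => (calDalev L M a ha k' + covPert L M (fun k'' ν' (x' : idx L M k'') => Complex.exp ((Complex.I * ((B₁ k'' ν' x' + B₂ k'' ν' x' : ℝ) : ℂ) / ((lev L k'' : ℕ) :
                ℂ)) * ((s : ℝ) : ℂ) + (Complex.I * ((A k'' ν' x' : ℝ) : ℂ) / ((lev L k'' : ℕ) : ℂ)) * ((r : ℝ) : ℂ))) k')⁻¹) k)⁻¹) 0) 0 :=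
    hessian_symm L M a ha A (fun k ν x => B₁ k ν x + B₂ k ν x) k
  rw [e1, hessian_add_left L M a ha B₁ B₂ A k, hessian_symm L M a ha B₁ A k, hessian_symm L M a ha B₂ A k]

/-- **`hessian_smul_right` — THE HESSIAN IS HOMOGENEOUS IN ITS SECOND ARGUMENT** (symmetry + `hessian_smul_left`), real `c`. [our proof] -/
theorem hessian_smul_right (c : ℝ) (A B : (k : ℕ) → Fin d → (idx L M k → ℝ)) (k : ℕ) :
    deriv (fun r : ℝ => deriv (fun s : ℝ => (avgTow (QBlev L M) ((L : ℝ) ^ d)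
          (fun k' => (calDalev L M a ha k' + covPert L M (fun k'' ν' (x' : idx L M k'') => Complex.exp ((Complex.I * ((A k'' ν' x' : ℝ) : ℂ) / ((lev L k'' : ℕ) : ℂ)) * ((s : ℝ) :
                ℂ) + (Complex.I * ((c * B k'' ν' x' : ℝ) : ℂ) / ((lev L k'' : ℕ) : ℂ)) * ((r : ℝ) : ℂ))) k')⁻¹) k)⁻¹) 0) 0
      = (c : ℂ) • deriv (fun r : ℝ => deriv (fun s : ℝ => (avgTow (QBlev L M) ((L : ℝ) ^ d)
          (fun k' => (calDalev L M a ha k' + covPert L M (fun k'' ν' (x' : idx L M k'') => Complex.exp ((Complex.I * ((A k'' ν' x' : ℝ) : ℂ) / ((lev L k'' : ℕ) : ℂ)) * ((s : ℝ) :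
                ℂ) + (Complex.I * ((B k'' ν' x' : ℝ) : ℂ) / ((lev L k'' : ℕ) : ℂ)) * ((r : ℝ) : ℂ))) k')⁻¹) k)⁻¹) 0) 0 := by
  have e1 : deriv (fun r : ℝ => deriv (fun s : ℝ => (avgTow (QBlev L M) ((L : ℝ) ^ d)
          (fun k' => (calDalev L M a ha k' + covPert L M (fun k'' ν' (x' : idx L M k'') => Complex.exp ((Complex.I * ((A k'' ν' x' : ℝ) : ℂ) / ((lev L k'' : ℕ) : ℂ)) * ((s : ℝ) :
                ℂ) + (Complex.I * ((c * B k'' ν' x' : ℝ) : ℂ) / ((lev L k'' : ℕ) : ℂ)) * ((r : ℝ) : ℂ))) k')⁻¹) k)⁻¹) 0) 0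
      = deriv (fun r : ℝ => deriv (fun s : ℝ => (avgTow (QBlev L M) ((L : ℝ) ^ d)
          (fun k' => (calDalev L M a ha k' + covPert L M (fun k'' ν' (x' : idx L M k'') => Complex.exp ((Complex.I * ((c * B k'' ν' x' : ℝ) : ℂ) / ((lev L k'' : ℕ) : ℂ)) * ((s :
                ℝ) : ℂ) + (Complex.I * ((A k'' ν' x' : ℝ) : ℂ) / ((lev L k'' : ℕ) : ℂ)) * ((r : ℝ) : ℂ))) k')⁻¹) k)⁻¹) 0) 0 :=
    hessian_symm L M a ha A (fun k ν x => c * B k ν x) k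
  rw [e1, hessian_smul_left L M a ha c B A k, hessian_symm L M a ha B A k]

end Form

end Summit.QuantumFields.BalabanUV.Beta.GAN24.ExponentialChartHessianForm

end
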